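import Literature.Computability.Complexity.PaulPippengerSzemerediTrotter1983Protocol
import HarnessLib

/-!
# Branch sets are small when `J` is a segregator (PPST 1983, §3; Santhanam 2001, §2)

Literature / complexity toolkit, thirteenth brick of the inline formalization of
Paul–Pippenger–Szemerédi–Trotter 1983 (`PaulPippengerSzemerediTrotter1983.lean`, fact
`PaulEtAl1983_NTIME_not_subset_DTIME`; roadmap Layer 4, sizes, part 1). The branch set of block
`j` (`TM2Blocks.branchSet`, `…Protocol.lean`: `j` and the blocks reaching `j` along last-toucher
edges with sources outside `J`) is what branch `j` of the four-alternation protocol recomputes.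
Here we bound its size by the segregator parameter: every element other than `j` is a direct
last-toucher predecessor `p ∉ J` of `j` or an ancestor of such a `p` inside `G − J`, there are at
most `2 |K|` direct predecessors (two touched height blocks per stack, `isWalk_blocks`), and each
has at most `M` ancestors in `G − J` when `J` is an `M`-segregator of the dependency graph
`depEdges` (`…Blocks.lean`, `…Segregators.lean`):

* `fst_lt_snd_of_mem_depEdges` (the dependency graph is forward), `finite_ancestorsAvoiding`;
* `mem_depEdges_of_truePredRel`, `mem_ancestorsAvoiding_of_transGen`;
* `directPreds`, `card_directPreds_le` (`≤ 2 |K|`), `mem_directPreds_of_truePredRel`;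
* **`card_branchSet_le`**: `|branchSet j| ≤ 1 + 2 |K| (M + 1)` for `j < N` when
  `IsSegregator M J (depEdges tm c₀ b N) N`.

No named fact is introduced (definitions with bodies and theorems only).

## References

* W. J. Paul, N. Pippenger, E. Szemerédi, W. T. Trotter, *On determinism versus non-determinism
  and related problems*, FOCS 1983, 429–438, §3 [PaulEtAl1983].
* R. Santhanam, *On separators, segregators and time versus space*, CCC 2001, §2 (p. 4)
  [Santhanam2001].
-/

namespace Literature.Computability.Complexity

open Turing Function Relation

namespace TM2Blocks

variable {tm : FinTM2}

/-! ### The dependency graph is forward; ancestor sets are finite -/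

/-- Every edge of the dependency graph goes forward in time. [folklore] -/
theorem fst_lt_snd_of_mem_depEdges {c₀ : tm.Cfg} {b N : ℕ} {e : ℕ × ℕ}
    (he : e ∈ depEdges tm c₀ b N) : e.1 < e.2 := by
  letI := tm.kFin
  unfold depEdges at he
  simp only [Finset.mem_union, Finset.mem_image, Finset.mem_range, Finset.mem_biUnion,
    Finset.mem_univ, true_and] at he
  rcases he with ⟨i, -, rfl⟩ | ⟨k, hk⟩
  · exact Nat.lt_succ_self i
  · unfold walkEdges at hk
    simp only [Finset.mem_filter] at hk
    obtain ⟨-, B, -, hlt⟩ := hk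
    exact (lastToucher_spec hlt).1

/-- Ancestor sets in the dependency graph lie below the vertex. [folklore] -/
theorem ancestorsAvoiding_subset_Iio (c₀ : tm.Cfg) (b N : ℕ) (J : Finset ℕ) (v : ℕ) :
    ancestorsAvoiding (depEdges tm c₀ b N) J v ⊆ Set.Iio v := by
  intro u hu
  simp only [ancestorsAvoiding, Set.mem_setOf_eq] at hu
  show u < v
  induction hu with
  | single h => exact fst_lt_snd_of_mem_depEdges h.1
  | tail _ h ih => exact lt_trans ih (fst_lt_snd_of_mem_depEdges h.1)

/-- Ancestor sets in the dependency graph are finite. [folklore] -/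
theorem finite_ancestorsAvoiding (c₀ : tm.Cfg) (b N : ℕ) (J : Finset ℕ) (v : ℕ) :
    (ancestorsAvoiding (depEdges tm c₀ b N) J v).Finite :=
  (Set.finite_Iio v).subset (ancestorsAvoiding_subset_Iio c₀ b N J v)

/-! ### Last-toucher predecessors are edges of the dependency graph -/

/-- A last-toucher predecessor of `u < N` is an edge of `depEdges … N`. [folklore] -/
theorem mem_depEdges_of_truePredRel {c₀ : tm.Cfg} {b N : ℕ} {J : Finset ℕ} {p u : ℕ}
    (h : truePredRel c₀ b J p u) (hu : u < N) : (p, u) ∈ depEdges tm c₀ b N := by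
  letI := tm.kFin
  obtain ⟨-, k, B, hlo, hhi, hlt⟩ := h
  have hpu := (lastToucher_spec hlt).1
  unfold depEdges
  simp only [Finset.mem_union, Finset.mem_biUnion, Finset.mem_univ, true_and]
  refine Or.inr ⟨k, ?_⟩
  unfold walkEdges
  simp only [Finset.mem_filter, Finset.mem_product, Finset.mem_range]
  exact ⟨⟨by omega, hu⟩, B, ⟨hlo, hhi⟩, hlt⟩

/-- Blocks reaching `p ∉ J` along last-toucher edges with sources outside `J` are ancestors of
`p` in `G − J`. [folklore] -/
theorem mem_ancestorsAvoiding_of_transGen {c₀ : tm.Cfg} {b N : ℕ} {J : Finset ℕ} {u p : ℕ}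
    (h : TransGen (truePredRel c₀ b J) u p) (hp : p ∉ J) (hpN : p < N) :
    u ∈ ancestorsAvoiding (depEdges tm c₀ b N) J p := by
  simp only [ancestorsAvoiding, Set.mem_setOf_eq]
  induction h with
  | single h => exact TransGen.single ⟨mem_depEdges_of_truePredRel h hpN, h.1, hp⟩
  | @tail c d hac hR ih =>
    have hc : c ∉ J := hR.1
    have hcd : c < d := truePredRel_lt hR
    exact TransGen.tail (ih hc (lt_trans hcd hpN)) ⟨mem_depEdges_of_truePredRel hR hpN, hc, hp⟩

/-! ### Direct predecessors -/

/-- The direct last-toucher predecessors of `j` (over all stacks and touched height blocks), as a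
finset. [folklore] -/
noncomputable def directPreds (c₀ : tm.Cfg) (b j : ℕ) : Finset ℕ :=
  letI := tm.kFin
  Finset.univ.biUnion fun k =>
    (Finset.Icc (lo tm c₀ b k j) (hi tm c₀ b k j)).biUnion fun B =>
      (lastToucher (lo tm c₀ b k) (hi tm c₀ b k) j B).toFinset

/-- A last-toucher predecessor is a direct predecessor. [folklore] -/
theorem mem_directPreds_of_truePredRel {c₀ : tm.Cfg} {b : ℕ} {J : Finset ℕ} {p j : ℕ}
    (h : truePredRel c₀ b J p j) : p ∈ directPreds c₀ b j := by
  letI := tm.kFin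
  obtain ⟨-, k, B, hlo, hhi, hlt⟩ := h
  unfold directPreds
  simp only [Finset.mem_biUnion, Finset.mem_univ, true_and, Finset.mem_Icc]
  exact ⟨k, B, ⟨hlo, hhi⟩, by simp [hlt]⟩

/-- At most two touched height blocks per stack: `|directPreds| ≤ 2 |K|`. [folklore] -/
theorem card_directPreds_le (c₀ : tm.Cfg) (b j : ℕ) :
    letI := tm.kFin
    (directPreds c₀ b j).card ≤ 2 * Fintype.card tm.K := by
  letI := tm.kFin
  unfold directPreds
  refine (Finset.card_biUnion_le).trans ?_
  have hk : ∀ k ∈ (Finset.univ : Finset tm.K),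
      ((Finset.Icc (lo tm c₀ b k j) (hi tm c₀ b k j)).biUnion fun B =>
        (lastToucher (lo tm c₀ b k) (hi tm c₀ b k) j B).toFinset).card ≤ 2 := by
    intro k _
    refine (Finset.card_biUnion_le).trans ?_
    have h1 : ∀ B ∈ Finset.Icc (lo tm c₀ b k j) (hi tm c₀ b k j),
        ((lastToucher (lo tm c₀ b k) (hi tm c₀ b k) j B).toFinset).card ≤ 1 := by
      intro B _
      cases lastToucher (lo tm c₀ b k) (hi tm c₀ b k) j B with
      | none => simp
      | some i => simp
    refine (Finset.sum_le_card_nsmul _ _ 1 h1).trans ?_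
    have htwo := (isWalk_blocks c₀ b k (j + 2)).two j
    simp only [Nat.card_Icc, smul_eq_mul, mul_one]
    omega
  refine (Finset.sum_le_card_nsmul _ _ 2 hk).trans ?_
  simp [Finset.card_univ, Nat.mul_comm]

/-! ### The size of a branch set -/

/-- **Branch sets are small for segregators**: if `J` is an `M`-segregator of the dependency graph
on `N` blocks, the branch set of any `j < N` has at most `1 + 2 |K| (M + 1)` elements — `j`, its
at most `2 |K|` direct predecessors outside `J`, and their at most `M` ancestors in `G − J` each.
[cite: Santhanam2001, §2 (p. 4)] [cite: PaulEtAl1983, §3] -/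
theorem card_branchSet_le {c₀ : tm.Cfg} {b N M : ℕ} {J : Finset ℕ}
    (hseg : IsSegregator M J (depEdges tm c₀ b N) N) {j : ℕ} (hj : j < N) :
    letI := tm.kFin
    (branchSet c₀ b J j).card ≤ 1 + 2 * Fintype.card tm.K * (M + 1) := by
  letI := tm.kFin
  classical
  -- the cluster of a direct predecessor: itself and, if outside `J`, its ancestors in `G − J`
  set cl : ℕ → Finset ℕ := fun p =>
    {p} ∪ (if p ∉ J then (finite_ancestorsAvoiding c₀ b N J p).toFinset else ∅) with hcl
  have hcl_card : ∀ p ∈ directPreds c₀ b j, (cl p).card ≤ M + 1 := by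
    intro p hp
    have hpj : p < j := by
      unfold directPreds at hp
      simp only [Finset.mem_biUnion, Finset.mem_univ, true_and, Option.mem_toFinset,
        Option.mem_def] at hp
      obtain ⟨k, B, -, hlt⟩ := hp
      exact (lastToucher_spec hlt).1
    refine (Finset.card_union_le _ _).trans ?_
    rw [Finset.card_singleton, Nat.add_comm]
    refine Nat.add_le_add_right ?_ 1
    by_cases hpJ : p ∈ J
    · rw [if_neg (not_not.2 hpJ)]; simp
    · rw [if_pos hpJ, ← Set.ncard_eq_toFinset_card _ (finite_ancestorsAvoiding c₀ b N J p)]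
      exact hseg p (by omega) hpJ
  -- covering
  have hcover : branchSet c₀ b J j ⊆ {j} ∪ (directPreds c₀ b j).biUnion cl := by
    intro u hu
    simp only [branchSet, Finset.mem_filter, Finset.mem_range] at hu
    obtain ⟨-, rfl | hu⟩ := hu
    · simp
    · rw [TransGen.tail'_iff] at hu
      obtain ⟨p, hup, hpj⟩ := hu
      have hpD := mem_directPreds_of_truePredRel hpj
      have hpJ : p ∉ J := hpj.1
      have hplt : p < j := truePredRel_lt hpj
      simp only [Finset.mem_union, Finset.mem_singleton, Finset.mem_biUnion]
      refine Or.inr ⟨p, hpD, ?_⟩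
      simp only [hcl, Finset.mem_union, Finset.mem_singleton, if_pos hpJ, Set.Finite.mem_toFinset]
      rcases (reflTransGen_iff_eq_or_transGen).1 hup with rfl | hup'
      · exact Or.inl rfl
      · exact Or.inr (mem_ancestorsAvoiding_of_transGen hup' hpJ (by omega))
  calc (branchSet c₀ b J j).card
      ≤ ({j} ∪ (directPreds c₀ b j).biUnion cl).card := Finset.card_le_card hcover
    _ ≤ 1 + ((directPreds c₀ b j).biUnion cl).card := by
        refine (Finset.card_union_le _ _).trans ?_; simp
    _ ≤ 1 + (directPreds c₀ b j).card * (M + 1) := by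
        refine Nat.add_le_add_left ((Finset.card_biUnion_le).trans ?_) 1
        simpa using Finset.sum_le_card_nsmul _ _ (M + 1) hcl_card
    _ ≤ 1 + 2 * Fintype.card tm.K * (M + 1) :=
        Nat.add_le_add_left (Nat.mul_le_mul_right _ (card_directPreds_le c₀ b j)) 1

end TM2Blocks

end Literature.Computability.Complexity
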